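import Mathlib
import HarnessLib

/-!
# `NoHeavyLowerTail` (stmt-CriticalPhenomena-4575) — hull-port line, THREE PORTS: the combinatorial certificate

Hull-port prover #4 (`prim-hp-4`, LP-duality technique), generation 2; `--supports stmt-CriticalPhenomena-4575`.  No sorries, no named
facts; the `def`s are finite bookkeeping gadgets (bit records and computable tables) for the Lean proof of the paper theorem XZport₃
(memo `run/shared/lean/prim/prim-hp-4/HULLPORT-LP.md` §9: CIL for every observer whose region has three hull ports), whose algebraic
core was landed measure-free in `…XZportThreeCore`.  This file is the WORLD-BY-WORLD layer in a form the kernel checks by evaluation.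
Setting (formalised in the companion files): observer `o`, ports `p 0` (the best port), `p 1`, `p 2`; NAMED POINTS `none = o`,
`some i = p i`.  A configuration determines inner bits `b : IB` (named points joined by open paths through the region), outer bits
`c : OB` (ports joined by open paths outside the region) and an antitone lightness function `H : M3 → ℝ` on port sets (`H I = 1` iff
the relays outer-joined to the ports in `I` number at most `j`).  Clusters of named points in the whole graph are read off the JOIN
`jrel` of the two relations ("a `base`-path of length ≤ 3", which on four points is the reflexive–transitive closure); `blkS`/`blkP`
are the port sets of the blocks of `o` / of `p k`.  The G-level quantities of the certificate become the functionals `FU, FSh, FA1,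
FA2, FA12` and `lhsF θ Λ α1 α2 α12 = θ·FU − Λ·(FSh 1 + FSh 2) − α1·FA1 − α2·FA2 − α12·FA12`; summing against the inner law
`x : IB → ℝ` gives `Phi`.  The constants `cst p… x` are the inner-law probabilities named in the memo (`s, i, d, a, g, a′`), and
`E1 … E4`, `k01`, `k02` are the four linear relations and two residual coefficients of `…XZportThreeCore`, homogeneous in the five
multipliers.  Main result `coef_identity` (kernel `decide`): on closed inner patterns the `H I`-coefficient vector of `lhsF` equals the
target vector `coefT` plus the integer combination `m1 … m4` of the coefficient vectors of `E1 … E4` — the five per-shape identities of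
`…XZportThreeCore` at once, join bookkeeping included.  Per-world positivity is derived in `…HullThreeWorld`.  Tables generated and
cross-checked by exact enumeration (session lab/xz3tab.py, lab/lawcheck.py).
-/

namespace Summit.CriticalPhenomena.PercolationContinuityZ3.Theorems

namespace HullThree

open Finset
open scoped BigOperators

/-! ### Bit records -/

/-- Inner reachability bits among the named points: `o k` = "`o` joined to port `k` through the region", `p01, p02, p12` =
"ports joined through the region". -/
structure IB where
  /-- `o` joined to port `0` -/
  o0 : Bool
  /-- `o` joined to port `1` -/
  o1 : Bool
  /-- `o` joined to port `2` -/
  o2 : Bool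
  /-- ports `0, 1` joined -/
  p01 : Bool
  /-- ports `0, 2` joined -/
  p02 : Bool
  /-- ports `1, 2` joined -/
  p12 : Bool
  deriving DecidableEq, Repr

/-- Outer reachability bits among the ports (open paths avoiding the region). -/
structure OB where
  /-- ports `0, 1` outer-joined -/
  q01 : Bool
  /-- ports `0, 2` outer-joined -/
  q02 : Bool
  /-- ports `1, 2` outer-joined -/
  q12 : Bool
  deriving DecidableEq, Repr

/-- A set of ports as a 3-bit mask. -/
structure M3 where
  /-- port `0` belongs -/
  m0 : Bool
  /-- port `1` belongs -/
  m1 : Bool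
  /-- port `2` belongs -/
  m2 : Bool
  deriving DecidableEq, Repr

/-- The 64 inner bit records, listed. -/
def IB.all : List IB :=
  (([true, false].flatMap fun a => [true, false].flatMap fun b => [true, false].flatMap fun c =>
    [true, false].flatMap fun d => [true, false].flatMap fun e => [true, false].map fun f => IB.mk a b c d e f))

/-- The 8 outer bit records, listed. -/
def OB.all : List OB :=
  [true, false].flatMap fun a => [true, false].flatMap fun b => [true, false].map fun c => OB.mk a b c

/-- The 8 masks, listed. -/
def M3.all : List M3 :=
  [true, false].flatMap fun a => [true, false].flatMap fun b => [true, false].map fun c => M3.mk a b c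

/-- `IB` is finite (64 records). -/
instance : Fintype IB where
  elems := IB.all.toFinset
  complete := by rintro ⟨a, b, c, d, e, f⟩; revert a b c d e f; decide

/-- `OB` is finite (8 records). -/
instance : Fintype OB where
  elems := OB.all.toFinset
  complete := by rintro ⟨a, b, c⟩; revert a b c; decide

/-- `M3` is finite (8 masks). -/
instance : Fintype M3 where
  elems := M3.all.toFinset
  complete := by rintro ⟨a, b, c⟩; revert a b c; decide

/-- Named points: `none` = the observer `o`, `some i` = the port `p i`. -/
abbrev NP := Option (Fin 3)

/-- Membership of a port in a mask. -/
def M3.mem (m : M3) (i : Fin 3) : Bool := ![m.m0, m.m1, m.m2] i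

/-- The mask of a decidable port predicate. -/
def M3.ofFn (f : Fin 3 → Bool) : M3 := ⟨f 0, f 1, f 2⟩

/-- Union of masks. -/
def M3.union (m m' : M3) : M3 := ⟨m.m0 || m'.m0, m.m1 || m'.m1, m.m2 || m'.m2⟩

/-- `m ⊆ m'` for masks. -/
def M3.sub (m m' : M3) : Bool := (!m.m0 || m'.m0) && (!m.m1 || m'.m1) && (!m.m2 || m'.m2)

/-- Membership in `M3.ofFn f` is `f`. -/
theorem M3.mem_ofFn (f : Fin 3 → Bool) (i : Fin 3) : (M3.ofFn f).mem i = f i := by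
  fin_cases i <;> rfl

/-- Membership in a union of masks. -/
theorem M3.mem_union (m m' : M3) (i : Fin 3) : (m.union m').mem i = (m.mem i || m'.mem i) := by
  fin_cases i <;> rfl

/-- `m.sub m'` is mask inclusion. -/
theorem M3.sub_iff (m m' : M3) : m.sub m' = true ↔ ∀ i, m.mem i = true → m'.mem i = true := by
  revert m m'; decide

/-! ### The inner and outer relations on named points and their join -/

/-- The `o`-bits of an inner record as a function. -/
def IB.ob (b : IB) : Fin 3 → Bool := ![b.o0, b.o1, b.o2]

/-- The port–port bits of an inner record as a (symmetric, irreflexive) table. -/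
def IB.pp (b : IB) : Fin 3 → Fin 3 → Bool :=
  ![![false, b.p01, b.p02], ![b.p01, false, b.p12], ![b.p02, b.p12, false]]

/-- The inner relation on named points encoded by `b` (off-diagonal). -/
def IB.rel (b : IB) : NP → NP → Bool
  | none, none => false
  | none, some i => b.ob i
  | some i, none => b.ob i
  | some i, some k => b.pp i k

/-- The port–port bits of an outer record as a table. -/
def OB.pp (c : OB) : Fin 3 → Fin 3 → Bool :=
  ![![false, c.q01, c.q02], ![c.q01, false, c.q12], ![c.q02, c.q12, false]]

/-- The outer relation on named points encoded by `c` (ports only). -/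
def OB.rel (c : OB) : NP → NP → Bool
  | some i, some k => c.pp i k
  | _, _ => false

/-- One step of the join: equal, inner-joined, or outer-joined. -/
def base (b : IB) (c : OB) (u v : NP) : Bool := decide (u = v) || b.rel u v || c.rel u v

/-- `∃` over the four named points, computably. -/
def anyNP (f : NP → Bool) : Bool := f none || f (some 0) || f (some 1) || f (some 2)

/-- `anyNP f` holds iff some named point satisfies `f`. -/
theorem anyNP_eq_true_iff (f : NP → Bool) : anyNP f = true ↔ ∃ u, f u = true := by
  constructor
  · intro h
    simp only [anyNP, Bool.or_eq_true] at h
    rcases h with ((h | h) | h) | h <;> exact ⟨_, h⟩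
  · rintro ⟨u, hu⟩
    simp only [anyNP, Bool.or_eq_true]
    rcases u with _ | i
    · exact Or.inl (Or.inl (Or.inl hu))
    · fin_cases i
      · exact Or.inl (Or.inl (Or.inr hu))
      · exact Or.inl (Or.inr hu)
      · exact Or.inr hu

/-- **The join** of the inner and outer relations on the four named points: "joined by a `base`-path of length ≤ 3", which on
four points is the reflexive–transitive closure (`…HullThreeJoin`). -/
def jrel (b : IB) (c : OB) (u v : NP) : Bool :=
  anyNP fun a => anyNP fun a' => base b c u a && (base b c a a' && base b c a' v)

/-- `jrel b c u v` holds iff there is a `base`-path `u → a → a' → v`. -/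
theorem jrel_eq_true_iff (b : IB) (c : OB) (u v : NP) :
    jrel b c u v = true ↔ ∃ a a', base b c u a = true ∧ base b c a a' = true ∧ base b c a' v = true := by
  simp only [jrel, anyNP_eq_true_iff, Bool.and_eq_true]

/-- Port set of the block of the observer in the join (`S = [o]`). -/
def blkS (b : IB) (c : OB) : M3 := M3.ofFn fun i => jrel b c none (some i)

/-- Port set of the block of the port `p k` in the join (`[p k]`). -/
def blkP (b : IB) (c : OB) (k : Fin 3) : M3 := M3.ofFn fun i => jrel b c (some k) (some i)

/-- The observer is attached (its inner block contains a port). -/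
def att (b : IB) : Bool := b.o0 || b.o1 || b.o2

/-- The all-off outer record (discrete outer shape). -/
def OB.disc : OB := ⟨false, false, false⟩

/-- An inner record is CLOSED (a genuine pattern) if the join with the discrete outer record does not add bits. -/
def IB.closed (b : IB) : Bool :=
  (jrel b OB.disc none (some 0) == b.o0) && (jrel b OB.disc none (some 1) == b.o1) &&
    (jrel b OB.disc none (some 2) == b.o2) && (jrel b OB.disc (some 0) (some 1) == b.p01) &&
    (jrel b OB.disc (some 0) (some 2) == b.p02) && (jrel b OB.disc (some 1) (some 2) == b.p12)

/-! ### The per-world functionals -/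

/-- `U`-functional: `1{att}·(H[p0] − H[S])` (target μ(M₀ ≤ j, o ↔ A) − μ(1 ≤ N ≤ j)). -/
noncomputable def FU (b : IB) (c : OB) (H : M3 → ℝ) : ℝ :=
  (if att b = true then H (blkP b c 0) else 0) - (if att b = true then H (blkS b c) else 0)

/-- Shift-row functional `Sh(0,k)`: `1{k ∈ S, 0 ∉ S}·(H[p0] − H[S])`. -/
noncomputable def FSh (k : Fin 3) (b : IB) (c : OB) (H : M3 → ℝ) : ℝ :=
  (if (blkS b c).mem k = true ∧ (blkS b c).mem 0 = false then H (blkP b c 0) else 0) -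
    (if (blkS b c).mem k = true ∧ (blkS b c).mem 0 = false then H (blkS b c) else 0)

/-- Observer-set functional `A[0;{1}]`: `1{1 ∉ [p0]}·(H[p0] − H[p1])`. -/
noncomputable def FA1 (b : IB) (c : OB) (H : M3 → ℝ) : ℝ :=
  (if (blkP b c 0).mem 1 = false then H (blkP b c 0) else 0) -
    (if (blkP b c 0).mem 1 = false then H (blkP b c 1) else 0)

/-- Observer-set functional `A[0;{2}]`: `1{2 ∉ [p0]}·(H[p0] − H[p2])`. -/
noncomputable def FA2 (b : IB) (c : OB) (H : M3 → ℝ) : ℝ :=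
  (if (blkP b c 0).mem 2 = false then H (blkP b c 0) else 0) -
    (if (blkP b c 0).mem 2 = false then H (blkP b c 2) else 0)

/-- Observer-set functional `A[0;{1,2}]`: `1{1,2 ∉ [p0]}·(H[p0] − H[[p1] ∪ [p2]])`. -/
noncomputable def FA12 (b : IB) (c : OB) (H : M3 → ℝ) : ℝ :=
  (if (blkP b c 0).mem 1 = false ∧ (blkP b c 0).mem 2 = false then H (blkP b c 0) else 0) -
    (if (blkP b c 0).mem 1 = false ∧ (blkP b c 0).mem 2 = false then H ((blkP b c 1).union (blkP b c 2)) else 0)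

/-- The per-world form `θ·U − Λ·(Sh(0,1)+Sh(0,2)) − α1·A[0;1] − α2·A[0;2] − α12·A[0;12]` on one pattern. -/
noncomputable def lhsF (θ Λ α1 α2 α12 : ℝ) (b : IB) (c : OB) (H : M3 → ℝ) : ℝ :=
  θ * FU b c H - Λ * (FSh 1 b c H + FSh 2 b c H) - α1 * FA1 b c H - α2 * FA2 b c H - α12 * FA12 b c H

/-- The per-world form integrated against the inner law `x`. -/
noncomputable def Phi (x : IB → ℝ) (θ Λ α1 α2 α12 : ℝ) (c : OB) (H : M3 → ℝ) : ℝ :=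
  ∑ b, x b * lhsF θ Λ α1 α2 α12 b c H

/-! ### Inner-law constants and the relations `E1 … E4`, residual coefficients `k01, k02` -/

/-- Sum of the inner law over a bit predicate. -/
noncomputable def cst (P : IB → Bool) (x : IB → ℝ) : ℝ := ∑ b, if P b = true then x b else 0

/-- mask `{0}` -/ def M0 : M3 := ⟨true, false, false⟩
/-- mask `{1}` -/ def M1 : M3 := ⟨false, true, false⟩
/-- mask `{2}` -/ def M2 : M3 := ⟨false, false, true⟩
/-- mask `{0,1}` -/ def M01 : M3 := ⟨true, true, false⟩
/-- mask `{0,2}` -/ def M02 : M3 := ⟨true, false, true⟩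
/-- mask `{1,2}` -/ def M12 : M3 := ⟨false, true, true⟩

/-- `S = {1}` -/ def pS1 (b : IB) : Bool := blkS b OB.disc == M1
/-- `S = {2}` -/ def pS2 (b : IB) : Bool := blkS b OB.disc == M2
/-- `[p1] = {1}` -/ def pI1 (b : IB) : Bool := blkP b OB.disc 1 == M1
/-- `[p2] = {2}` -/ def pI2 (b : IB) : Bool := blkP b OB.disc 2 == M2
/-- `[p0] = {0}` -/ def pI0 (b : IB) : Bool := blkP b OB.disc 0 == M0
/-- ports pairwise inner-separated -/ def pD (b : IB) : Bool := pI0 b && pI1 b && pI2 b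
/-- `S = {1}`, ports separated -/ def pA1 (b : IB) : Bool := pS1 b && pD b
/-- `S = {2}`, ports separated -/ def pA2 (b : IB) : Bool := pS2 b && pD b
/-- `S = {1,2}` -/ def pA12 (b : IB) : Bool := blkS b OB.disc == M12
/-- `[p1] = {1,2}` -/ def pG12 (b : IB) : Bool := blkP b OB.disc 1 == M12
/-- `[p0] = {0,1}` -/ def pG01 (b : IB) : Bool := blkP b OB.disc 0 == M01
/-- `[p0] = {0,2}` -/ def pG02 (b : IB) : Bool := blkP b OB.disc 0 == M02
/-- `S = {2}`, `[p0] = {0,1}` -/ def pA2p (b : IB) : Bool := pS2 b && pG01 b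
/-- `S = {1}`, `[p0] = {0,2}` -/ def pA1p (b : IB) : Bool := pS1 b && pG02 b

/-- `E1 = (θ − 2Λ)(a1 + a2 + a12) − (α1 + α2 + α12)·i0`. -/
noncomputable def E1 (x : IB → ℝ) (θ Λ α1 α2 α12 : ℝ) : ℝ :=
  (θ - 2 * Λ) * (cst pA1 x + cst pA2 x + cst pA12 x) - (α1 + α2 + α12) * cst pI0 x

/-- `E2 = α1·i1 − (θ − Λ)·s1`. -/
noncomputable def E2 (x : IB → ℝ) (θ Λ α1 : ℝ) : ℝ := α1 * cst pI1 x - (θ - Λ) * cst pS1 x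

/-- `E3 = α2·i2 − (θ − Λ)·s2`. -/
noncomputable def E3 (x : IB → ℝ) (θ Λ α2 : ℝ) : ℝ := α2 * cst pI2 x - (θ - Λ) * cst pS2 x

/-- `E4 = (θ − 2Λ)·a12 − (α1 + α2)·g12 − α12·i0`. -/
noncomputable def E4 (x : IB → ℝ) (θ Λ α1 α2 α12 : ℝ) : ℝ :=
  (θ - 2 * Λ) * cst pA12 x - (α1 + α2) * cst pG12 x - α12 * cst pI0 x

/-- Residual coefficient `k01 = α2·g01 − (θ − Λ)·a2p` (multiplies `H{0} − H{0,1}` in the discrete world). -/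
noncomputable def k01 (x : IB → ℝ) (θ Λ α2 : ℝ) : ℝ := α2 * cst pG01 x - (θ - Λ) * cst pA2p x

/-- Residual coefficient `k02 = α1·g02 − (θ − Λ)·a1p` (multiplies `H{0} − H{0,2}` in the discrete world). -/
noncomputable def k02 (x : IB → ℝ) (θ Λ α1 : ℝ) : ℝ := α1 * cst pG02 x - (θ - Λ) * cst pA1p x

/-! ### Integer coefficient tables -/

/-- `[P]` as an integer. -/
def ι (P : Prop) [Decidable P] : ℤ := if P then 1 else 0

/-- A coefficient vector over the five multiplier slots `θ, Λ, α1, α2, α12`. -/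
structure C5 where
  /-- coefficient of `θ` -/
  t : ℤ
  /-- coefficient of `Λ` -/
  l : ℤ
  /-- coefficient of `α1` -/
  a : ℤ
  /-- coefficient of `α2` -/
  b : ℤ
  /-- coefficient of `α12` -/
  e : ℤ
  deriving DecidableEq, Repr

/-- zero vector -/
def C5.zero : C5 := ⟨0, 0, 0, 0, 0⟩

/-- sum of coefficient vectors -/
def C5.add (p q : C5) : C5 := ⟨p.t + q.t, p.l + q.l, p.a + q.a, p.b + q.b, p.e + q.e⟩

/-- difference of coefficient vectors -/
def C5.sub (p q : C5) : C5 := ⟨p.t - q.t, p.l - q.l, p.a - q.a, p.b - q.b, p.e - q.e⟩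

/-- integer multiple of a coefficient vector -/
def C5.smul (z : ℤ) (p : C5) : C5 := ⟨z * p.t, z * p.l, z * p.a, z * p.b, z * p.e⟩

/-- Evaluation of a coefficient vector at real multipliers. -/
noncomputable def C5.ev (p : C5) (θ Λ α1 α2 α12 : ℝ) : ℝ :=
  θ * p.t + Λ * p.l + α1 * p.a + α2 * p.b + α12 * p.e

/-- `H I`-coefficient of `FU`. -/
def cU (b : IB) (c : OB) (I : M3) : ℤ := ι (att b = true ∧ blkP b c 0 = I) - ι (att b = true ∧ blkS b c = I)

/-- `H I`-coefficient of `FSh k`. -/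
def cSh (k : Fin 3) (b : IB) (c : OB) (I : M3) : ℤ :=
  ι (((blkS b c).mem k = true ∧ (blkS b c).mem 0 = false) ∧ blkP b c 0 = I) -
    ι (((blkS b c).mem k = true ∧ (blkS b c).mem 0 = false) ∧ blkS b c = I)

/-- `H I`-coefficient of `FA1`. -/
def cA1 (b : IB) (c : OB) (I : M3) : ℤ :=
  ι ((blkP b c 0).mem 1 = false ∧ blkP b c 0 = I) - ι ((blkP b c 0).mem 1 = false ∧ blkP b c 1 = I)

/-- `H I`-coefficient of `FA2`. -/
def cA2 (b : IB) (c : OB) (I : M3) : ℤ :=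
  ι ((blkP b c 0).mem 2 = false ∧ blkP b c 0 = I) - ι ((blkP b c 0).mem 2 = false ∧ blkP b c 2 = I)

/-- `H I`-coefficient of `FA12`. -/
def cA12 (b : IB) (c : OB) (I : M3) : ℤ :=
  ι (((blkP b c 0).mem 1 = false ∧ (blkP b c 0).mem 2 = false) ∧ blkP b c 0 = I) -
    ι (((blkP b c 0).mem 1 = false ∧ (blkP b c 0).mem 2 = false) ∧ (blkP b c 1).union (blkP b c 2) = I)

/-- `H I`-coefficients of `lhsF` over the multiplier slots. -/
def coefL (b : IB) (c : OB) (I : M3) : C5 :=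
  ⟨cU b c I, -(cSh 1 b c I + cSh 2 b c I), -cA1 b c I, -cA2 b c I, -cA12 b c I⟩

/-- `x b`-coefficients of `E1`. -/
def cE1 (b : IB) : C5 :=
  ⟨ι (pA1 b = true) + ι (pA2 b = true) + ι (pA12 b = true),
    -2 * (ι (pA1 b = true) + ι (pA2 b = true) + ι (pA12 b = true)),
    -ι (pI0 b = true), -ι (pI0 b = true), -ι (pI0 b = true)⟩

/-- `x b`-coefficients of `E2`. -/
def cE2 (b : IB) : C5 := ⟨-ι (pS1 b = true), ι (pS1 b = true), ι (pI1 b = true), 0, 0⟩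

/-- `x b`-coefficients of `E3`. -/
def cE3 (b : IB) : C5 := ⟨-ι (pS2 b = true), ι (pS2 b = true), 0, ι (pI2 b = true), 0⟩

/-- `x b`-coefficients of `E4`. -/
def cE4 (b : IB) : C5 :=
  ⟨ι (pA12 b = true), -2 * ι (pA12 b = true), -ι (pG12 b = true), -ι (pG12 b = true), -ι (pI0 b = true)⟩

/-- `x b`-coefficients of `k01`. -/
def cK01 (b : IB) : C5 := ⟨-ι (pA2p b = true), ι (pA2p b = true), 0, ι (pG01 b = true), 0⟩

/-- `x b`-coefficients of `k02`. -/
def cK02 (b : IB) : C5 := ⟨-ι (pA1p b = true), ι (pA1p b = true), ι (pG02 b = true), 0, 0⟩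

/-- Target coefficients: in the discrete outer world `k01·(H{0} − H{0,1}) + k02·(H{0} − H{0,2})`, else `0`. -/
def coefT (c : OB) (I : M3) (b : IB) : C5 :=
  if c = OB.disc then
    ((if I = M0 then (cK01 b).add (cK02 b) else C5.zero).sub (if I = M01 then cK01 b else C5.zero)).sub
      (if I = M02 then cK02 b else C5.zero)
  else C5.zero

/-- Multiplier of `E1` in the per-world identity (shape "the two worse ports outer-joined"). -/
def m1 (c : OB) (I : M3) : ℤ := if c = ⟨false, false, true⟩ then ι (I = M0) - ι (I = M12) else 0

/-- Multiplier of `E2` (discrete shape and shape "ports 0, 2 outer-joined"). -/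
def m2 (c : OB) (I : M3) : ℤ :=
  if c = OB.disc then ι (I = M1) - ι (I = M0) else if c = ⟨false, true, false⟩ then ι (I = M1) - ι (I = M02) else 0

/-- Multiplier of `E3` (discrete shape and shape "ports 0, 1 outer-joined"). -/
def m3 (c : OB) (I : M3) : ℤ :=
  if c = OB.disc then ι (I = M2) - ι (I = M0) else if c = ⟨true, false, false⟩ then ι (I = M2) - ι (I = M01) else 0

/-- Multiplier of `E4` (discrete shape). -/
def m4 (c : OB) (I : M3) : ℤ := if c = OB.disc then ι (I = M0) - ι (I = M12) else 0

/-- **The coefficient identity** (all outer shapes at once; kernel decision over the 15 closed inner patterns × 8 outer records ×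
8 masks, five slots each): `coefL = coefT + m1·cE1 + m2·cE2 + m3·cE3 + m4·cE4` coefficientwise.  The multipliers `m1 … m4` were
found by LP duality (they are the `linear_combination` coefficients of `…XZportThreeCore`, with the join bookkeeping included). -/
theorem coef_identity : ∀ b : IB, b.closed = true → ∀ (c : OB) (I : M3),
    coefL b c I = (coefT c I b).add
      ((((cE1 b).smul (m1 c I)).add ((cE2 b).smul (m2 c I))).add
        (((cE3 b).smul (m3 c I)).add ((cE4 b).smul (m4 c I)))) := by
  decide +kernel

end HullThree

end Summit.CriticalPhenomena.PercolationContinuityZ3.Theorems
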